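import Literature.Analysis.FluidPDE.KatoLaiLevelRuns
import Literature.Analysis.FluidPDE.SpaceTimeFiniteOrderCalculus
import HarnessLib

/-!
# Kato–Lai in the periodic cylinder: the uniform-time existence theorem (discharge of
# `KatoLai1984_periodicCylinderUniformExistence`)

Analysis/FluidPDE. This file assembles the energy-method construction of Euler flows in the
periodic cylinder `{r ≤ 1} × ℝ/Lℤ` (the chain `KatoLaiSymOperator` → `KatoLaiSymForm` →
`KatoLaiLevelPath` → `KatoLaiTimeRegularity` → `KatoLaiEvaluation` → `KatoLaiPhysicalVelocity` →
`KatoLaiCellIdentification` → `KatoLaiLevelRuns`, after T. Kato, C. Y. Lai, *Nonlinear evolution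
equations and the Euler flow*, J. Funct. Anal. **56** (1984) 15–28, Thm A, Thm I with its
uniformity clause, Thm II) into the named fact
`Literature.Analysis.FluidPDE.KatoLai1984_periodicCylinderUniformExistence` of
`Ferrari1993Continuation.lean` (which is upstream of the construction, hence the discharge in this
sibling file):

* `contDiffOn_slicePressure_nat` — **joint regularity of the pressure, order by order**: if the
  velocity agrees on the closed cylinder with a field `w` jointly `C^{n+1}` on `[0, T] × ℝ³` and
  satisfies the Euler equation with slice pressures `π(t)` smooth on the closed cylinder, then
  `(t, x) ↦ π(t, x) − π(t, 0)` is jointly `C^n` on `[0, T) × closed cylinder` — it is the segment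
  potential `∫₀¹ ⟪Ψ_w(t, σx), x⟫ dσ` of the jointly `C^n` field
  `Ψ_w = ∂ₜw + (w·∇)w` (`contDiffOn_segmentIntegral_nat`), by the fundamental theorem of calculus
  along radii of the (star-shaped) closed cylinder;
* `exists_eulerSolution` — from a smooth periodic datum `φ`, divergence free and tangential, a
  solution `(u, p)` of the periodic class `IsPeriodicCylinderEulerSolution L [0, T₁) φ` for every
  `0 < T₁ ≤ T♯(φ)`: `u = φ + (v − v(0))` with `v` the velocity of the level runs (`= v` on the
  closed cylinder, `= φ` at `t = 0` everywhere), `p(t) = π(t, 0) − π(t, ·)` with `π(t)` Kato–Lai's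
  pressure of `v(t)`;
* `exists_uniform_time` and **`KatoLai1984_periodicCylinderUniformExistence_holds`** — the
  uniform time `T₁(L, M) = T♯` evaluated at the bound `lowE (toL2 U₀) + 1 ≤ c C_L M² + 1`
  (`lowE_toL2_le`, `exists_latNormSq_torusRep_le`) of the level-`3` energy by the `H³(cell)` norm.

Everything is proved; no named fact and no `sorry` is introduced.

## References

* T. Kato, C. Y. Lai, J. Funct. Anal. 56 (1984) 15–28, Thm A, Thm I, Thm II. [KatoLai1984]
* A. B. Ferrari, Comm. Math. Phys. 155 (1993) 277–294, Thm 1 and pp. 282–283. [Ferrari1993]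
-/

noncomputable section

open MeasureTheory Set Function Filter Topology TopologicalSpace
open scoped NNReal ENNReal InnerProductSpace RealInnerProductSpace ContDiff

namespace Literature.Analysis.FluidPDE

open FunctionSpaces FunctionSpaces.Torus UnitAddTorus

/-- Local notation for physical space `ℝ³ = EuclideanSpace ℝ (Fin 3)`. -/
local notation "ℝ³" => EuclideanSpace ℝ (Fin 3)

/-- Local notation for the closed cylinder `{r ≤ 1}`. -/
local notation "𝕂" => closure (SetLike.coe unitCylinder : Set (EuclideanSpace ℝ (Fin 3)))

namespace PeriodicCylinder

variable {L : ℝ} (hL : 0 < L)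

/-! ### Radii of the closed cylinder -/

section Segment

/-- The closed cylinder is star-shaped about the origin. [folklore] -/
theorem smul_mem_K {x : ℝ³} (hx : x ∈ 𝕂) {σ : ℝ} (hσ : σ ∈ Icc (0 : ℝ) 1) : σ • x ∈ 𝕂 := by
  rw [closure_unitCylinder] at hx ⊢
  have h : cylRadius (σ • x) = |σ| * cylRadius x := cylRadius_smul σ x
  have hr : cylRadius x ≤ 1 := hx
  show cylRadius (σ • x) ≤ 1
  rw [h, abs_of_nonneg hσ.1]
  calc σ * cylRadius x ≤ 1 * 1 := mul_le_mul hσ.2 hr (cylRadius_nonneg x) zero_le_one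
    _ = 1 := one_mul _

/-- Proper radii of the closed cylinder lie in the open cylinder. [folklore] -/
theorem smul_mem_unitCylinder {x : ℝ³} (hx : x ∈ 𝕂) {σ : ℝ} (hσ : σ ∈ Ioo (0 : ℝ) 1) :
    σ • x ∈ (unitCylinder : Set ℝ³) := by
  rw [closure_unitCylinder] at hx
  have hr : cylRadius x ≤ 1 := hx
  rw [SetLike.mem_coe, mem_unitCylinder, cylRadius_smul, abs_of_pos hσ.1]
  calc σ * cylRadius x ≤ σ * 1 := mul_le_mul_of_nonneg_left hr hσ.1.le
    _ < 1 := by linarith [hσ.2]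

/-- The origin lies in the closed cylinder. [folklore] -/
theorem zero_mem_K : (0 : ℝ³) ∈ 𝕂 := by
  rw [closure_unitCylinder]
  show cylRadius 0 ≤ 1
  have : cylRadius (0 : ℝ³) = 0 := by
    have h := cylRadius_smul 0 (0 : ℝ³)
    rw [zero_smul, abs_zero, zero_mul] at h
    exact h
  rw [this]; exact zero_le_one

end Segment

/-! ### Joint regularity of the pressure, order by order -/

section Pressure

/-- **Joint `C^n` regularity of the normalised slice pressures.** Let `T > 0`; let `v` agree on the
closed cylinder, at all times of `[0, T]`, with a field `w` jointly `C^{n+1}` on `[0, T] × ℝ³`; let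
`π(t)`, `t ∈ [0, T)`, be smooth on the closed cylinder, and suppose the Euler equation
`∂ₜ v(·, x) = −((v·∇)v − ∇_K π(t))(x)` within `[0, T]` at every `t < T` and `x` in the open cylinder.
Then `(t, x) ↦ π(t, x) − π(t, 0)` is jointly `C^n` on `[0, T) × closed cylinder`.
[cite: KatoLai1984, Thm II (proof: time derivatives from the equations)] -/
theorem contDiffOn_slicePressure_nat (n : ℕ) {T : ℝ} (hT : 0 < T) {v w : ℝ → ℝ³ → ℝ³} {π : ℝ → ℝ³ → ℝ}
    (hw : ContDiffOn ℝ (n + 1) (uncurry w) (Icc 0 T ×ˢ (univ : Set ℝ³)))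
    (hvw : ∀ t ∈ Icc 0 T, EqOn (v t) (w t) 𝕂)
    (hπ : ∀ t ∈ Ico 0 T, ContDiffOn ℝ ∞ (π t) 𝕂)
    (hmom : ∀ t ∈ Ico 0 T, ∀ x ∈ (unitCylinder : Set ℝ³),
      HasDerivWithinAt (fun τ => v τ x) (-(convect (v t) (v t) x - cylGrad (π t) x)) (Icc 0 T) t) :
    ContDiffOn ℝ n (uncurry fun t x => π t x - π t 0) (Ico 0 T ×ˢ 𝕂) := by
  have hU : UniqueDiffOn ℝ (Icc 0 T) := uniqueDiffOn_Icc hT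
  -- the jointly `C^n` field `Ψ = ∂ₜ w + (w·∇)w`
  set Ψ : ℝ → ℝ³ → ℝ³ := fun t y => timeDerivWithin (Icc 0 T) w t y + convect (w t) (w t) y with hΨ
  have hΨreg : ContDiffOn ℝ n (uncurry Ψ) (Icc 0 T ×ˢ univ) :=
    (contDiffOn_timeDerivWithin_nat hw hU).add (contDiffOn_convect_nat (hw.of_le le_self_add) hw hU)
  have hP : ContDiffOn ℝ n (uncurry fun t x => ∫ σ in (0 : ℝ)..1, ⟪Ψ t (σ • x), x⟫_ℝ) (Icc 0 T ×ˢ univ) :=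
    contDiffOn_segmentIntegral_nat (convex_Icc 0 T) hU n hΨreg
  -- `Ψ(t) = ∇_K π(t)` in the open cylinder, `t < T`
  have hΨΩ : ∀ t ∈ Ico 0 T, ∀ y ∈ (unitCylinder : Set ℝ³), Ψ t y = cylGrad (π t) y := by
    intro t ht y hy
    have ht' : t ∈ Icc 0 T := ⟨ht.1, ht.2.le⟩
    have hyK : y ∈ 𝕂 := subset_closure hy
    have h1 : timeDerivWithin (Icc 0 T) w t y = -(convect (v t) (v t) y - cylGrad (π t) y) := by
      rw [timeDerivWithin_apply, derivWithin_congr (fun τ hτ => (hvw τ hτ hyK).symm) (hvw t ht' hyK).symm]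
      exact (hmom t ht y hy).derivWithin (hU t ht')
    have hev : w t =ᶠ[𝓝 y] v t := by
      filter_upwards [unitCylinder.isOpen.mem_nhds hy] with z hz
      exact (hvw t ht' (subset_closure hz)).symm
    have h2 : convect (w t) (w t) y = convect (v t) (v t) y := by
      simp only [convect, hev.fderiv_eq, hev.eq_of_nhds]
    simp only [hΨ, h1, h2]
    abel
  -- the fundamental theorem of calculus along the radius through `x`
  have hId : ∀ t ∈ Ico 0 T, ∀ x ∈ 𝕂, ∫ σ in (0 : ℝ)..1, ⟪Ψ t (σ • x), x⟫_ℝ = π t x - π t 0 := by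
    intro t ht x hx
    have ht' : t ∈ Icc 0 T := ⟨ht.1, ht.2.le⟩
    have hπt := hπ t ht
    have hg_cont : ContinuousOn (fun σ : ℝ => π t (σ • x)) (Icc 0 1) :=
      hπt.continuousOn.comp (continuous_id.smul continuous_const).continuousOn fun σ hσ => smul_mem_K hx hσ
    have hg_deriv : ∀ σ ∈ Ioo (0 : ℝ) 1, HasDerivAt (fun σ : ℝ => π t (σ • x)) (⟪Ψ t (σ • x), x⟫_ℝ) σ := by
      intro σ hσ
      have hyO := smul_mem_unitCylinder hx hσ
      have hdiff : DifferentiableAt ℝ (π t) (σ • x) :=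
        ((hπt.differentiableOn (by simp)) (σ • x) (smul_mem_K hx ⟨hσ.1.le, hσ.2.le⟩)).differentiableAt
          (closure_unitCylinder_mem_nhds hyO)
      have hc := hdiff.hasFDerivAt.comp_hasDerivAt σ ((hasDerivAt_id σ).smul_const x)
      rw [one_smul] at hc
      rw [hΨΩ t ht _ hyO, cylGrad_eq_gradient _ hyO, _root_.gradient, InnerProductSpace.toDual_symm_apply]
      exact hc
    have hint : IntervalIntegrable (fun σ : ℝ => ⟪Ψ t (σ • x), x⟫_ℝ) volume 0 1 :=
      ((((contDiff_slice_of_contDiffOn hΨreg ht').continuous).comp (continuous_id.smul continuous_const)).inner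
        continuous_const).intervalIntegrable 0 1
    have h := intervalIntegral.integral_eq_sub_of_hasDerivAt_of_le zero_le_one hg_cont hg_deriv hint
    simpa using h
  -- conclude by congruence on `[0, T) × closed cylinder`
  refine (hP.mono (prod_mono Ico_subset_Icc_self (subset_univ _))).congr ?_
  rintro ⟨t, x⟩ ⟨ht, hx⟩
  exact (hId t ht x hx).symm

end Pressure

/-! ### The solution from a datum -/

section Solution

variable {φ : ℝ³ → ℝ³} (hφ : IsSmoothPeriodic L φ)
  (hdiv : ∀ x ∈ (unitCylinder : Set ℝ³), VectorCalculus.divergence φ x = 0)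
  (hslip : ∀ x ∈ frontier (unitCylinder : Set ℝ³), ⟪φ x, eR x⟫_ℝ = 0)

include hdiv hslip in
/-- **Kato–Lai's Theorems I and II in the periodic cylinder, from a smooth datum.** For `φ` smooth
on the closed cylinder, `L`-periodic, divergence free in `{r < 1}` and tangential on `{r = 1}`, and
every `T₁ ≤ T♯(φ)`, there are `u, p` with `IsPeriodicCylinderEulerSolution L [0, T₁) φ u p`
(for `T₁ ≤ 0` the time set is empty).
[cite: KatoLai1984, Thm I and Thm II (p. 17)] -/
theorem exists_eulerSolution {T₁ : ℝ} (hT₁le : T₁ ≤ sharpTime hL (lowE (toL2 (isSmooth_torusRep hφ)) + 1)) :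
    ∃ (u : ℝ → ℝ³ → ℝ³) (p : ℝ → ℝ³ → ℝ), IsPeriodicCylinderEulerSolution L (Ico 0 T₁) φ u p := by
  have hex : ∀ s', 7 ≤ s' → ∃ G', LevelRun hL s' (isSmooth_torusRep hφ) (sharpTime hL (lowE (toL2 (isSmooth_torusRep hφ)) + 1)) G' :=
    fun s' hs' => exists_levelRun hL hφ hdiv hslip hs'
  obtain ⟨G, hG⟩ := hex 7 le_rfl
  set T := sharpTime hL (lowE (toL2 (isSmooth_torusRep hφ)) + 1) with hTdef
  have hT : 0 < T := hG.pos
  -- the velocity of the level runs is `pathVel L G`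
  have hvK : ∀ t ∈ Icc 0 T, IsSmoothPeriodic L (pathVel L G t) := fun t ht => hG.isSmoothPeriodic_pathVel (by norm_num) hex ht
  have hvreg : ContDiffOn ℝ ∞ (uncurry (pathVel L G)) (Icc 0 T ×ˢ 𝕂) := hG.contDiffOn_pathVel_infty (by norm_num) hex
  have hv0 : EqOn (pathVel L G 0) φ 𝕂 := hG.pathVel_zero_eqOn hφ
  -- Kato–Lai's pressure of the slices
  set π : ℝ → ℝ³ → ℝ := fun t =>
    if ht : t ∈ Icc 0 T then pressurePot hL (isSmoothPeriodic_fromTorus hL.ne' (isSmooth_torusRep (hvK t ht))) else fun _ => 0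
    with hπdef
  have hπ_of : ∀ {t : ℝ} (ht : t ∈ Icc 0 T),
      π t = pressurePot hL (isSmoothPeriodic_fromTorus hL.ne' (isSmooth_torusRep (hvK t ht))) := fun ht => by
    simp only [hπdef, dif_pos ht]
  have hπreg : ∀ t ∈ Ico 0 T, ContDiffOn ℝ ∞ (π t) 𝕂 := fun t ht => by
    rw [hπ_of ⟨ht.1, ht.2.le⟩]; exact (isSmoothPeriodic_pressurePot hL _).smooth
  -- the Euler equation of `v`
  have hmom : ∀ t ∈ Ico 0 T, ∀ x ∈ (unitCylinder : Set ℝ³),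
      HasDerivWithinAt (fun τ => pathVel L G τ x) (-(convect (pathVel L G t) (pathVel L G t) x - cylGrad (π t) x)) (Icc 0 T) t := by
    intro t ht x hx
    rw [hπ_of ⟨ht.1, ht.2.le⟩]
    exact hG.hasDerivWithinAt_pathVel (by norm_num) ht (hvK t ⟨ht.1, ht.2.le⟩) hx
  -- the solution
  set u : ℝ → ℝ³ → ℝ³ := fun t x => φ x + (pathVel L G t x - pathVel L G 0 x) with hudef
  set p : ℝ → ℝ³ → ℝ := fun t x => π t 0 - π t x with hpdef
  have hS : Ico 0 T₁ ⊆ Ico 0 T := Ico_subset_Ico le_rfl hT₁le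
  have hSI : Ico 0 T₁ ⊆ Icc 0 T := hS.trans Ico_subset_Icc_self
  have huv : ∀ t, EqOn (u t) (pathVel L G t) 𝕂 := fun t x hx => by
    show φ x + (pathVel L G t x - pathVel L G 0 x) = pathVel L G t x
    rw [hv0 hx]; abel
  -- joint smoothness of the velocity
  have hsu : ContDiffOn ℝ ∞ (uncurry u) (Ico 0 T₁ ×ˢ 𝕂) := by
    have h1 : ContDiffOn ℝ ∞ (fun z : ℝ × ℝ³ => φ z.2) (Ico 0 T₁ ×ˢ 𝕂) := hφ.smooth.comp contDiff_snd.contDiffOn fun z hz => hz.2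
    have h2 : ContDiffOn ℝ ∞ (uncurry (pathVel L G)) (Ico 0 T₁ ×ˢ 𝕂) := hvreg.mono (prod_mono hSI Subset.rfl)
    have h3 : ContDiffOn ℝ ∞ (fun z : ℝ × ℝ³ => pathVel L G 0 z.2) (Ico 0 T₁ ×ˢ 𝕂) :=
      hvreg.comp ((contDiff_const (c := (0 : ℝ))).prodMk contDiff_snd).contDiffOn fun z hz => ⟨⟨le_rfl, hT.le⟩, hz.2⟩
    exact h1.add (h2.sub h3)
  -- joint smoothness of the pressure, order by order
  have hsp : ContDiffOn ℝ ∞ (uncurry p) (Ico 0 T₁ ×ˢ 𝕂) := by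
    refine contDiffOn_infty.2 fun n => ?_
    obtain ⟨G', hG'⟩ := hex (3 * n + 8) (by omega)
    obtain ⟨δ', hW'⟩ := hG'.windowed
    have hw' : ContDiffOn ℝ (n + 1) (uncurry (pathVel L G')) (Icc 0 T ×ˢ (univ : Set ℝ³)) := by
      have hw := hW'.contDiffOn_pathVel (n := n + 1) (p := 2 * n + 6) (by omega) (by omega)
      exact_mod_cast hw
    have hvw : ∀ t ∈ Icc 0 T, EqOn (pathVel L G t) (pathVel L G' t) 𝕂 := fun t ht => hG.eqOn_pathVel hG' (by norm_num) (by omega) ht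
    have h := contDiffOn_slicePressure_nat n hT hw' hvw hπreg hmom
    exact (h.neg.mono (prod_mono hS Subset.rfl)).congr fun z _ => by
      show π z.1 0 - π z.1 z.2 = -(π z.1 z.2 - π z.1 0); abel
  refine ⟨u, p, ⟨⟨hsu.of_le (by exact_mod_cast le_top), hsp.of_le (by exact_mod_cast le_top)⟩, ?_, ?_, ?_⟩,
    ?_, hsu, hsp, ?_⟩
  · -- momentum
    intro t ht x hx
    have ht' : t ∈ Ico 0 T := hS ht
    have htI : t ∈ Icc 0 T := hSI ht
    have hd := hG.hasDerivWithinAt_pathVel (by norm_num) ht' (hvK t htI) hx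
    have hdu : HasDerivWithinAt (fun τ => u τ x)
        (-(convect (pathVel L G t) (pathVel L G t) x - pressureGrad hL (isSmoothPeriodic_fromTorus hL.ne' (isSmooth_torusRep (hvK t htI))) x))
        (Ico 0 T₁) t := by
      refine ((hd.const_add (φ x - pathVel L G 0 x)).mono hSI).congr (fun τ _ => ?_) ?_
      · show φ x + (pathVel L G τ x - pathVel L G 0 x) = φ x - pathVel L G 0 x + pathVel L G τ x
        abel
      · show φ x + (pathVel L G t x - pathVel L G 0 x) = φ x - pathVel L G 0 x + pathVel L G t x
        abel
    have h1 : timeDerivWithin (Ico 0 T₁) u t x =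
        -(convect (pathVel L G t) (pathVel L G t) x - pressureGrad hL (isSmoothPeriodic_fromTorus hL.ne' (isSmooth_torusRep (hvK t htI))) x) :=
      hdu.derivWithin (uniqueDiffOn_Ico 0 T₁ t ht)
    have hev : u t =ᶠ[𝓝 x] pathVel L G t := by
      filter_upwards [unitCylinder.isOpen.mem_nhds hx] with y hy
      exact huv t (subset_closure hy)
    have h2 : convect (u t) (u t) x = convect (pathVel L G t) (pathVel L G t) x := by
      simp only [convect, hev.fderiv_eq, hev.eq_of_nhds]
    have h3 : _root_.gradient (p t) x = -_root_.gradient (π t) x := by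
      show _root_.gradient (fun y => π t 0 - π t y) x = _
      rw [_root_.gradient, _root_.gradient, fderiv_const_sub, map_neg]
    have h4 : _root_.gradient (π t) x = pressureGrad hL (isSmoothPeriodic_fromTorus hL.ne' (isSmooth_torusRep (hvK t htI))) x := by
      rw [hπ_of htI, pressureGrad, cylGrad_eq_gradient _ hx]
    rw [h1, h2, h3, h4]
    simp only [Pi.zero_apply, add_zero, neg_neg]
    abel
  · -- incompressibility
    intro t ht x hx
    have htI : t ∈ Icc 0 T := hSI ht
    have hev : u t =ᶠ[𝓝 x] pathVel L G t := by
      filter_upwards [unitCylinder.isOpen.mem_nhds hx] with y hy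
      exact huv t (subset_closure hy)
    have h := (hG.divergence_slip (by norm_num) htI (hvK t htI)).1 x hx
    unfold VectorCalculus.divergence at h ⊢
    rw [hev.fderiv_eq]
    exact h
  · -- slip
    intro t ht x hx
    have htI : t ∈ Icc 0 T := hSI ht
    rw [huv t (frontier_subset_closure hx)]
    exact (hG.divergence_slip (by norm_num) htI (hvK t htI)).2 x hx
  · -- initial datum
    funext x
    show φ x + (pathVel L G 0 x - pathVel L G 0 x) = φ x
    simp
  · -- periodicity
    intro t ht
    have htI : t ∈ Icc 0 T := hSI ht
    refine ⟨fun x => ?_, fun x => ?_⟩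
    · show φ _ + (pathVel L G t _ - pathVel L G 0 _) = φ x + (pathVel L G t x - pathVel L G 0 x)
      rw [hφ.periodic x, isAxiallyPeriodic_pathVel hL.ne' G t x, isAxiallyPeriodic_pathVel hL.ne' G 0 x]
    · show π t 0 - π t _ = π t 0 - π t x
      rw [hπ_of htI, (isSmoothPeriodic_pressurePot hL _).periodic x]

end Solution

/-! ### The uniform time -/

section Uniform

include hL in
/-- **The uniform existence time.** For `L > 0` and `M ≥ 0` there is `T₁ = T₁(L, M) > 0` such
that every smooth periodic datum, divergence free and tangential, of `H³(cell)` norm at most `M`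
launches a solution of the periodic class on `[0, T₁)`. [cite: KatoLai1984, Thm I (uniformity clause) and Thm II (p. 17)] -/
theorem exists_uniform_time (M : ℝ≥0) : ∃ T₁ : ℝ, 0 < T₁ ∧
    ∀ (φ : ℝ³ → ℝ³) (_hsmooth : ContDiffOn ℝ ∞ φ 𝕂) (_hper : IsAxiallyPeriodic L φ)
      (_hdiv : ∀ x ∈ (unitCylinder : Set ℝ³), VectorCalculus.divergence φ x = 0)
      (_hslip : ∀ x ∈ frontier (unitCylinder : Set ℝ³), ⟪φ x, eR x⟫_ℝ = 0)
      (_hM : eSobolevDomainNorm 3 2 (cylinderCell L) volume φ ≤ M),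
      ∃ (u : ℝ → ℝ³ → ℝ³) (p : ℝ → ℝ³ → ℝ), IsPeriodicCylinderEulerSolution L (Ico 0 T₁) φ u p := by
  obtain ⟨C, hC0, hC⟩ := exists_latNormSq_torusRep_le hL 3
  set c : ℝ := 1 + 3 * (2 * Real.pi) ^ (2 * 3) with hc
  have hc0 : 0 ≤ c := by positivity
  have hY : 0 < c * C * (M : ℝ) ^ 2 + 1 := by positivity
  refine ⟨sharpTime hL (c * C * (M : ℝ) ^ 2 + 1), sharpTime_pos hL hY, fun φ hsmooth hper hdiv hslip hM => ?_⟩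
  have hφ : IsSmoothPeriodic L φ := ⟨hsmooth, hper⟩
  have hY₀ : 0 < lowE (toL2 (isSmooth_torusRep hφ)) + 1 := by
    have := lowE_nonneg (toL2 (isSmooth_torusRep hφ)); positivity
  refine exists_eulerSolution hL hφ hdiv hslip (sharpTime_antitone hL hY₀ ?_)
  -- `lowE (toL2 U₀) + 1 ≤ c C M² + 1`
  have hfin : eSobolevDomainNorm 3 2 (cylinderCell L) volume φ < ⊤ := eSobolevDomainNorm_lt_top_of_isSmoothPeriodic L 3 hφ.smooth
  have h3 : (eSobolevDomainNorm 3 2 (cylinderCell L) volume φ).toReal ≤ M := by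
    have := ENNReal.toReal_mono ENNReal.coe_ne_top hM
    rwa [ENNReal.coe_toReal] at this
  have h4 : (eSobolevDomainNorm 3 2 (cylinderCell L) volume φ).toReal ^ 2 ≤ (M : ℝ) ^ 2 :=
    pow_le_pow_left₀ ENNReal.toReal_nonneg h3 2
  have key : lowE (toL2 (isSmooth_torusRep hφ)) ≤ c * C * (M : ℝ) ^ 2 :=
    calc lowE (toL2 (isSmooth_torusRep hφ)) ≤ c * Torus.latNormSq 3 (torusRep L φ) := lowE_toL2_le (isSmooth_torusRep hφ)
      _ ≤ c * (C * (eSobolevDomainNorm 3 2 (cylinderCell L) volume φ).toReal ^ 2) := mul_le_mul_of_nonneg_left (hC φ hφ) hc0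
      _ ≤ c * (C * (M : ℝ) ^ 2) := mul_le_mul_of_nonneg_left (mul_le_mul_of_nonneg_left h4 hC0) hc0
      _ = c * C * (M : ℝ) ^ 2 := by ring
  linarith

end Uniform

end PeriodicCylinder

/-- **Kato–Lai 1984, Theorems I and II in the periodic cylinder with the uniform existence time:
discharge of `KatoLai1984_periodicCylinderUniformExistence`.** [cite: KatoLai1984, Thm I and Thm II (p. 17)] -/
theorem KatoLai1984_periodicCylinderUniformExistence_holds : KatoLai1984_periodicCylinderUniformExistence :=
  fun _ hL M => PeriodicCylinder.exists_uniform_time hL M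

end Literature.Analysis.FluidPDE
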